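import Literature.AlgebraicGeometry.Motives.RationalDegreeOneModelWeilType
import Literature.AlgebraicGeometry.Motives.HyperbolicWeilTypeProduct
import Literature.AlgebraicGeometry.Motives.AbelianVarietyCohomologyExteriorH1
import HarnessLib

/-!
# Crux `WeilTwelvefoldsSqrtMinus7` (stmt-HodgeConjecture-1261), line `amnesic-secant-sheaves-split-fourteenfolds` — lemmas for stub `stub_aimedFrameOfModel_of` (γ, r6)

Helper file of the stub γ (the ASSEMBLY of the aiming half of the product trick: E. Markman,
arXiv:2509.23403 §11.5 Step 2; B. van Geemen, LNM 1594 (1994), Lemma 5.2 (2)–(5), 5.3, 5.4; C. Schoen,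
Compositio 114 (1998) §10), on the tree's real carriers `complexBetti – k = Hᵏ(–(ℂ); ℂ)`. It packages
the two RATIONAL DEGREE-ONE MODELS the assembly feeds to `Theorems.exists_isotropic_blockVectors'` and
`Motives.isHyperbolicWeilType_prod_of_rationalModels`:

* `af_weilModel` — for a Weil pair `(A, φ)` of dimension `2n ≥ 2`, `φ ≫ φ = -7`, a `K`-symmetric class
  `h` (`φ^* h = 7 h`) and a rational basis `u` of `H¹(A(ℂ); ℂ)` with matrix `M_A` of `φ^*` and Gram
  matrix `G_A` of `Q_h = h^{2n-1} ⌣ (· ⌣ ·)`: the model is of WEIL TYPE `G_A(M_A v, M_A w) = 7 G_A(v, w)`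
  (`Motives.gram_map_eq_mul_gram`, with `H• = ⋀• H¹`, `Motives.abelianVarietyCohomologyExteriorH1_holds`),
  ALTERNATING (`Motives.gram_antisymm`), `M_A² = -7` (`(φ^*)² = -7` on `H¹`,
  `complexBetti_map_map_one_of_comp_self`) and has `4n = b₁(A)` vectors;
* `af_partnerModel` — for an elliptic curve `(E, φ)`, `φ ≫ φ = -7`, with an integer model `(x, M)` of
  `φ^*` on `H¹`: `M² = -7` over `ℚ`, the binary Gram matrix `!![0, 1; -1, 0]` of `xᵢ ⌣ xⱼ` with respect to
  `η₀ = x₀ ⌣ x₁` (graded commutativity), the matrices `± M` of `(± φ)^*`, and the `K`-symmetry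
  `(φ, -φ)^*(pr₁^*(c₁ η₀) + pr₂^*(c₂ η₀)) = 7 · (…)` of the weighted product class of `E × E`
  (`(±φ)^* = 7` on `H²(E) = ⋀² H¹`, `Motives.map_top_eq_pow_smul`).

Pure bookkeeping over theorems of the tree; no named fact is taken.
-/

noncomputable section

set_option linter.dupNamespace false

open CategoryTheory Complex
open Literature.AlgebraicGeometry Literature.AlgebraicGeometry.Motives
  Literature.AlgebraicGeometry.HodgeTheory Literature.AlgebraicTopology.SingularHomology
open Literature.Geometry.Kaehler

namespace Summit.HodgeConjecture.HodgeConjecture.Theorems.WeilTwelvefoldsSqrtMinus7.AmnesicSecantSheaves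

/-! ## Linear algebra of rational models -/

section LinearAlgebra

/-- **The square of the model matrix from the square of the operator.** If `u` is a `ℂ`-linearly
independent family, `T uᵢ = Σⱼ M j i • uⱼ` for a rational matrix `M`, and `T (T uᵢ) = c • uᵢ`
(`c ∈ ℚ`), then `M² = c` on coordinate vectors: `M (M v) = c • v`. [folklore] -/
theorem af_mulVec_mulVec_of_frame {V : Type*} [AddCommGroup V] [Module ℂ V] {ι : Type*} [Fintype ι]
    [DecidableEq ι] (T : V →ₗ[ℂ] V) (u : ι → V) (hu : LinearIndependent ℂ u) (M : Matrix ι ι ℚ)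
    (hM : ∀ i, T (u i) = ∑ j, ((M j i : ℚ) : ℂ) • u j) (c : ℚ)
    (hT : ∀ i, T (T (u i)) = ((c : ℚ) : ℂ) • u i) (v : ι → ℚ) :
    M.mulVec (M.mulVec v) = c • v := by
  -- `(M * M) k i = c δ_{ki}`
  have hcoef : ∀ i k, (M * M) k i = if k = i then c else 0 := by
    intro i
    have h1 : T (T (u i)) = ∑ k, (((M * M) k i : ℚ) : ℂ) • u k := by
      rw [hM i, map_sum]
      simp only [map_smul, hM, Finset.smul_sum, smul_smul]
      rw [Finset.sum_comm]
      refine Finset.sum_congr rfl fun k _ => ?_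
      rw [← Finset.sum_smul, Matrix.mul_apply]
      push_cast
      refine congrArg (· • u k) (Finset.sum_congr rfl fun j _ => ?_)
      ring
    have h2 : ∑ k, ((((M * M) k i : ℚ) : ℂ) - if k = i then ((c : ℚ) : ℂ) else 0) • u k = 0 := by
      simp only [sub_smul, Finset.sum_sub_distrib, ite_smul, zero_smul, Finset.sum_ite_eq',
        Finset.mem_univ, if_true]
      rw [← h1, hT i, sub_self]
    intro k
    have h3 := Fintype.linearIndependent_iff.1 hu _ h2 k
    rw [sub_eq_zero] at h3
    by_cases hki : k = i
    · rw [if_pos hki] at h3 ⊢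
      exact_mod_cast h3
    · rw [if_neg hki] at h3 ⊢
      exact_mod_cast h3
  rw [Matrix.mulVec_mulVec]
  funext k
  simp only [Matrix.mulVec, dotProduct, Pi.smul_apply, smul_eq_mul]
  simp_rw [hcoef _ k]
  simp only [ite_mul, zero_mul, Finset.sum_ite_eq, Finset.mem_univ, if_true]

/-- **Weil type in bilinear form** from the entrywise identity `Σ_{a,b} M a i G a b M b k = d G i k`
(`Mᵀ G M = d G`): `(M v) ⬝ G (M w) = d · (v ⬝ G w)`. [folklore] -/
theorem af_weil_mulVec_of_entries {ι : Type*} [Fintype ι] (M G : Matrix ι ι ℚ) (d : ℚ)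
    (h : ∀ i k, ∑ a, ∑ b, M a i * G a b * M b k = d * G i k) (v w : ι → ℚ) :
    M.mulVec v ⬝ᵥ G.mulVec (M.mulVec w) = d * (v ⬝ᵥ G.mulVec w) := by
  have hMGM : M.transpose * G * M = d • G := by
    ext i k
    rw [Matrix.smul_apply, smul_eq_mul, ← h i k, Matrix.mul_apply, Finset.sum_comm]
    refine Finset.sum_congr rfl fun a _ => ?_
    rw [Matrix.mul_apply, Finset.sum_mul]
    refine Finset.sum_congr rfl fun b _ => ?_
    rw [Matrix.transpose_apply]
  calc M.mulVec v ⬝ᵥ G.mulVec (M.mulVec w)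
        = v ⬝ᵥ (M.transpose * G * M).mulVec w := by
          rw [← Matrix.vecMul_transpose, ← Matrix.dotProduct_mulVec, Matrix.mulVec_mulVec,
            Matrix.mulVec_mulVec, Matrix.mul_assoc]
      _ = d * (v ⬝ᵥ G.mulVec w) := by
          rw [hMGM, Matrix.smul_mulVec, dotProduct_smul, smul_eq_mul]

/-- **Alternation in bilinear form** from `G i k = -G k i`: `w ⬝ G v = -(v ⬝ G w)`. [folklore] -/
theorem af_antisymm_mulVec_of_entries {ι : Type*} [Fintype ι] (G : Matrix ι ι ℚ)
    (h : ∀ i k, G i k = -G k i) (v w : ι → ℚ) :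
    w ⬝ᵥ G.mulVec v = -(v ⬝ᵥ G.mulVec w) := by
  have hGt : G.transpose = -G := by
    ext i k
    rw [Matrix.transpose_apply, Matrix.neg_apply, h k i]
  rw [Matrix.dotProduct_mulVec, dotProduct_comm, ← Matrix.mulVec_transpose, hGt, Matrix.neg_mulVec,
    dotProduct_neg]

/-- The binary alternating Gram matrix `!![0, 1; -1, 0]` is alternating in bilinear form. [folklore] -/
theorem af_GE_antisymm (a b : Fin 2 → ℚ) :
    b ⬝ᵥ (!![0, 1; -1, 0] : Matrix (Fin 2) (Fin 2) ℚ).mulVec a =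
      -(a ⬝ᵥ (!![0, 1; -1, 0] : Matrix (Fin 2) (Fin 2) ℚ).mulVec b) :=
  af_antisymm_mulVec_of_entries _ (fun i k => by fin_cases i <;> fin_cases k <;> simp) a b

end LinearAlgebra

/-! ## The curve `E` and the partner surface `E × E` -/

section Partner

variable {E : AbelianVariety ℂ}

/-- `φ ≫ φ = -7` with the scalar `7` read in `ℕ`. [folklore] -/
theorem af_comp_self_nsmul {A : AbelianVariety ℂ} {φ : A ⟶ A} (hφ : φ ≫ φ = -((7 : ℤ) • 𝟙 A)) :
    φ ≫ φ = -((7 : ℕ) • 𝟙 A) := by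
  rw [hφ, ← natCast_zsmul]; rfl

/-- `(-φ) ≫ (-φ) = φ ≫ φ = -7` (van Geemen's conjugate action `ῑ`). [cite: vanGeemen1994HodgeAV, Lemma 5.3] -/
theorem af_neg_comp_neg {A : AbelianVariety ℂ} {φ : A ⟶ A} (hφ : φ ≫ φ = -((7 : ℤ) • 𝟙 A)) :
    (-φ) ≫ (-φ) = -((7 : ℤ) • 𝟙 A) := by
  rw [Preadditive.neg_comp, Preadditive.comp_neg, neg_neg, hφ]

/-- **An isogeny `φ` with `φ ≫ φ = -7` of an elliptic curve acts on `H²(E(ℂ); ℂ)` by `7`** (its degree: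
`φ^* = det(φ^*|_{H¹}) = 7` on `H² = ⋀² H¹`, the tree's `Motives.map_top_eq_pow_smul` with
`H• = ⋀• H¹`, `Motives.abelianVarietyCohomologyExteriorH1_holds`). [cite: LangeBirkenhake1992, Prop. 1.1.9 and Lemma 1.1.17] -/
theorem af_map_two_curve (hE : E.dim = 1) {φ : E ⟶ E} (hφ : φ ≫ φ = -((7 : ℤ) • 𝟙 E))
    (η : complexBetti E.X 2) : complexBetti.map φ.hom.hom.hom 2 η = (7 : ℂ) • η := by
  have hE' : E.dim = 0 + 1 := hE
  have h := map_top_eq_pow_smul (j := 0) hE' (abelianVarietyCohomologyExteriorH1_holds.finrank_one E)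
    (abelianVarietyCohomologyExteriorH1_holds.span_range_cupPowOne E (2 + 2 * 0)) (d := 7) (by norm_num)
    (af_comp_self_nsmul hφ) η
  simpa using h

/-- The integer model matrix of `φ^*` on the frame `x`, read over `ℚ`. [folklore] -/
theorem af_map_eq_sum_ratCast (φ : E ⟶ E) (x : Fin 2 → complexBetti E.X 1) (M : Matrix (Fin 2) (Fin 2) ℤ)
    (hM : ∀ i, complexBetti.map φ.hom.hom.hom 1 (x i) = ∑ j, ((M j i : ℤ) : ℂ) • x j) (i : Fin 2) :
    complexBetti.map φ.hom.hom.hom 1 (x i) = ∑ j, (((M.map (Int.cast : ℤ → ℚ)) j i : ℚ) : ℂ) • x j := by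
  rw [hM i]
  refine Finset.sum_congr rfl fun j _ => ?_
  rw [Matrix.map_apply, Rat.cast_intCast]

/-- `(-φ)^*` has matrix `-M` on the frame `x` (pull-back on `H¹` is additive in the homomorphism,
`complexBetti_map_neg_one`). [cite: LangeBirkenhake1992, §1.1 (p. 19)] -/
theorem af_map_neg_eq_sum_ratCast (φ : E ⟶ E) (x : Fin 2 → complexBetti E.X 1)
    (M : Matrix (Fin 2) (Fin 2) ℤ)
    (hM : ∀ i, complexBetti.map φ.hom.hom.hom 1 (x i) = ∑ j, ((M j i : ℤ) : ℂ) • x j) (i : Fin 2) :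
    complexBetti.map (-φ).hom.hom.hom 1 (x i) = ∑ j, (((-(M.map (Int.cast : ℤ → ℚ))) j i : ℚ) : ℂ) • x j := by
  have h : complexBetti.map (-φ).hom.hom.hom 1 (x i) = -(complexBetti.map φ.hom.hom.hom 1 (x i)) := by
    rw [complexBetti_map_neg_one]; rfl
  rw [h, af_map_eq_sum_ratCast φ x M hM i, ← Finset.sum_neg_distrib]
  refine Finset.sum_congr rfl fun j _ => ?_
  rw [Matrix.neg_apply, Rat.cast_neg, neg_smul]

/-- **`M² = -7` on coordinate vectors** for the rational model matrix `M` of `φ^*` on a basis of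
`H¹(E(ℂ); ℂ)`, `φ ≫ φ = -7` (`(φ^*)² = -7` on `H¹`, `complexBetti_map_map_one_of_comp_self`).
[cite: vanGeemen1994HodgeAV, 4.9 and Lemma 5.3] -/
theorem af_ME_mulVec_mulVec {φ : E ⟶ E} (hφ : φ ≫ φ = -((7 : ℤ) • 𝟙 E)) (x : Fin 2 → complexBetti E.X 1)
    (hxi : LinearIndependent ℂ x) (M : Matrix (Fin 2) (Fin 2) ℤ)
    (hM : ∀ i, complexBetti.map φ.hom.hom.hom 1 (x i) = ∑ j, ((M j i : ℤ) : ℂ) • x j) (v : Fin 2 → ℚ) :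
    (M.map (Int.cast : ℤ → ℚ)).mulVec ((M.map (Int.cast : ℤ → ℚ)).mulVec v) = -((7 : ℚ) • v) := by
  have h := af_mulVec_mulVec_of_frame (complexBetti.map φ.hom.hom.hom 1).hom x hxi (M.map (Int.cast : ℤ → ℚ))
    (fun i => af_map_eq_sum_ratCast φ x M hM i) (-7) (fun i => ?_) v
  · rw [h, neg_smul]
  · have h2 := complexBetti_map_map_one_of_comp_self (af_comp_self_nsmul hφ) (x i)
    change complexBetti.map φ.hom.hom.hom 1 (complexBetti.map φ.hom.hom.hom 1 (x i)) = _
    rw [h2]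
    push_cast
    rw [neg_smul]

/-- **The Gram matrix of the cup product on `H¹` of the curve in the frame `x` is `!![0, 1; -1, 0]`
times `η₀ = x₀ ⌣ x₁`** (graded commutativity: `xᵢ ⌣ xᵢ = 0`, `x₁ ⌣ x₀ = -x₀ ⌣ x₁`); the exponent-`0`
polarization pairing `Q_{h,0}(x, y) = x ⌣ y` does not depend on `h`. [cite: HatcherAT2002, Thm. 3.11] -/
theorem af_gram_curve (x : Fin 2 → complexBetti E.X 1) (h : complexBetti E.X 2) (i j : Fin 2) :
    polarizationPairingOne E.X h 0 (x i) (x j) =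
      (((!![0, 1; -1, 0] : Matrix (Fin 2) (Fin 2) ℚ) i j : ℚ) : ℂ) • cupProduct (rfl : 1 + 1 = 2) (x 0) (x 1) := by
  rw [polarizationPairingOne_apply]
  simp only [lefschetzPow_zero, LinearMap.id_apply]
  have hself : ∀ v : complexBetti E.X 1, cupProduct (rfl : 1 + 1 = 2) v v = 0 := fun v => by
    have h := cupProduct_gradedComm_holds ℂ (ComplexPoints E.X) (rfl : 1 + 1 = 2) (rfl : 1 + 1 = 2) v v
    rw [mul_one, pow_one, neg_one_smul] at h
    have h2 : (2 : ℂ) • cupProduct (rfl : 1 + 1 = 2) v v = 0 := by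
      rw [two_smul]
      nth_rewrite 1 [h]
      exact neg_add_cancel _
    exact (smul_eq_zero.1 h2).resolve_left two_ne_zero
  have hcomm : ∀ u w : complexBetti E.X 1,
      cupProduct (rfl : 1 + 1 = 2) w u = -cupProduct (rfl : 1 + 1 = 2) u w := fun u w => by
    have h := cupProduct_gradedComm_holds ℂ (ComplexPoints E.X) (rfl : 1 + 1 = 2) (rfl : 1 + 1 = 2) w u
    rwa [mul_one, pow_one, neg_one_smul] at h
  fin_cases i <;> fin_cases j <;> simp [hself, hcomm (x 0) (x 1)]

/-- The top power of a class of the curve in exponent-`0` form: `L⁰_{c η} (c η) = c • η`. [folklore] -/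
theorem af_top_curve (η : complexBetti E.X 2) (c : ℚ) :
    lefschetzPow (((c : ℚ) : ℂ) • η) 0 2 (((c : ℚ) : ℂ) • η) = ((c : ℚ) : ℂ) • η := by
  simp [lefschetzPow_zero]

/-- **`ψ = (φ, -φ)` multiplies the weighted product class of `E × E` by `7`**:
`ψ^*(pr₁^*(c₁ η) + pr₂^*(c₂ η)) = 7 · (pr₁^*(c₁ η) + pr₂^*(c₂ η))` (`(±φ)^* η = 7 η` on `H²(E)`).
[cite: vanGeemen1994HodgeAV, Lemma 5.3] -/
theorem af_partner_symm (hE : E.dim = 1) {φ : E ⟶ E} (hφ : φ ≫ φ = -((7 : ℤ) • 𝟙 E))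
    (η : complexBetti E.X 2) (c₁ c₂ : ℂ) :
    complexBetti.map (AbelianVariety.prodLift (AbelianVariety.fst E E ≫ φ)
        (AbelianVariety.snd E E ≫ (-φ))).hom.hom.hom 2
      (complexBetti.map (AbelianVariety.fst E E).hom.hom.hom 2 (c₁ • η) +
        complexBetti.map (AbelianVariety.snd E E).hom.hom.hom 2 (c₂ • η)) =
    (7 : ℂ) • (complexBetti.map (AbelianVariety.fst E E).hom.hom.hom 2 (c₁ • η) +
        complexBetti.map (AbelianVariety.snd E E).hom.hom.hom 2 (c₂ • η)) := by
  have h1 : complexBetti.map φ.hom.hom.hom 2 (c₁ • η) = (7 : ℂ) • (c₁ • η) := by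
    rw [map_smul, af_map_two_curve hE hφ, smul_comm]
  have h2 : complexBetti.map (-φ).hom.hom.hom 2 (c₂ • η) = (7 : ℂ) • (c₂ • η) := by
    rw [map_smul, af_map_two_curve hE (af_neg_comp_neg hφ), smul_comm]
  rw [map_add, map_prodLift_map_fst, map_prodLift_map_snd, h1, h2]
  simp only [map_smul, smul_add]

end Partner

/-! ## The two packaged models -/

/-- **The rational degree-one model of a `K`-symmetrically polarised Weil pair is of Weil type,
alternating, with `M_A² = -7`, on `4n` vectors** (van Geemen, LNM 1594, 4.9 and Lemma 5.2 (2):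
`(√-7)^* E = 7 E`; the Gram matrix of `Q_h(uᵢ, uⱼ) = h^{2n-1} ⌣ uᵢ ⌣ uⱼ` is alternating by graded
commutativity; `(φ^*)² = -7` on `H¹`; `b₁(A) = 2 dim A`). The four hypotheses `hWA`, `hGAt`, `hMA`, `hcard`
of `Theorems.exists_isotropic_blockVectors'`, in its bilinear (`mulVec`/`⬝ᵥ`) form.
[cite: vanGeemen1994HodgeAV, 4.9 and Lemma 5.2 (2)] [cite: LangeBirkenhake1992, Prop. 1.1.9 and Lemma 1.1.17] -/
theorem af_weilModel {n : ℕ} {A : AbelianVariety ℂ} {φ : A ⟶ A} (hn : 1 ≤ n) (hA : A.dim = 2 * n)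
    (hφ : φ ≫ φ = -((7 : ℤ) • 𝟙 A)) {h : complexBetti A.X 2}
    (hh : complexBetti.map φ.hom.hom.hom 2 h = (7 : ℂ) • h) {r : ℕ} {u : Fin r → complexBetti A.X 1}
    (hui : LinearIndependent ℂ u) (hus : Submodule.span ℂ (Set.range u) = ⊤) {MA : Matrix (Fin r) (Fin r) ℚ}
    (hMA : ∀ i, complexBetti.map φ.hom.hom.hom 1 (u i) = ∑ j, ((MA j i : ℚ) : ℂ) • u j)
    {ω : complexBetti A.X (2 + 2 * (2 * n - 1))} (hω0 : ω ≠ 0) {GA : Matrix (Fin r) (Fin r) ℚ}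
    (hGA : ∀ i j, polarizationPairingOne A.X h (2 * n - 1) (u i) (u j) = ((GA i j : ℚ) : ℂ) • ω) :
    (∀ v w : Fin r → ℚ, MA.mulVec v ⬝ᵥ GA.mulVec (MA.mulVec w) = 7 * (v ⬝ᵥ GA.mulVec w)) ∧
    (∀ v w : Fin r → ℚ, w ⬝ᵥ GA.mulVec v = -(v ⬝ᵥ GA.mulVec w)) ∧
    (∀ v : Fin r → ℚ, MA.mulVec (MA.mulVec v) = -((7 : ℚ) • v)) ∧
    Fintype.card (Fin r) = 4 * n := by
  have hA' : A.dim = (2 * n - 1) + 1 := by rw [hA]; omega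
  have hφ' : φ ≫ φ = -((7 : ℕ) • 𝟙 A) := af_comp_self_nsmul hφ
  have hh' : complexBetti.map φ.hom.hom.hom 2 h = ((7 : ℕ) : ℂ) • h := by rw [hh, Nat.cast_ofNat]
  refine ⟨fun v w => ?_, af_antisymm_mulVec_of_entries GA (gram_antisymm _ _ u hω0 GA hGA), fun v => ?_, ?_⟩
  · have e := af_weil_mulVec_of_entries MA GA ((7 : ℕ) : ℚ) (gram_map_eq_mul_gram hA'
      (abelianVarietyCohomologyExteriorH1_holds.finrank_one A)
      (abelianVarietyCohomologyExteriorH1_holds.span_range_cupPowOne A (2 + 2 * (2 * n - 1)))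
      (d := 7) (by norm_num) hφ' hh' u MA hMA hω0 GA hGA) v w
    rw [e, Nat.cast_ofNat]
  · have e := af_mulVec_mulVec_of_frame (complexBetti.map φ.hom.hom.hom 1).hom u hui MA hMA (-7)
      (fun i => ?_) v
    · rw [e, neg_smul]
    · have h2 := complexBetti_map_map_one_of_comp_self hφ' (u i)
      change complexBetti.map φ.hom.hom.hom 1 (complexBetti.map φ.hom.hom.hom 1 (u i)) = _
      rw [h2]
      push_cast
      rw [neg_smul]
  · have h1 := finrank_span_eq_card (R := ℂ) hui
    rw [hus, finrank_top, abelianVarietyCohomologyExteriorH1_holds.finrank_one A, hA] at h1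
    omega

/-- **The binary partner model of the CM curve.** For an elliptic curve `E` with `φ ≫ φ = -7` and an
integer model `(x, M)` of `φ^*` on a basis `x₀, x₁` of `H¹(E(ℂ); ℂ)`: `M² = -7` over `ℚ`; the Gram
matrix of `Q_{h,0}(xᵢ, xⱼ) = xᵢ ⌣ xⱼ` is `!![0, 1; -1, 0] · η₀`, `η₀ = x₀ ⌣ x₁`, and it is alternating;
`(±φ)^*` have the matrices `±M`; `L⁰_{cη₀}(cη₀) = c η₀`; and `ψ = (φ, -φ)` multiplies the weighted
product class `pr₁^*(c₁ η₀) + pr₂^*(c₂ η₀)` of `E × E` by `7` (van Geemen's CM example `(ι, ῑ)`).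
[cite: vanGeemen1994HodgeAV, Lemma 5.2 (2) and 5.3] [cite: HatcherAT2002, Thm. 3.11] -/
theorem af_partnerModel {E : AbelianVariety ℂ} {φ : E ⟶ E} (hE : E.dim = 1) (hφ : φ ≫ φ = -((7 : ℤ) • 𝟙 E))
    (x : Fin 2 → complexBetti E.X 1) (hxi : LinearIndependent ℂ x) (M : Matrix (Fin 2) (Fin 2) ℤ)
    (hM : ∀ i, complexBetti.map φ.hom.hom.hom 1 (x i) = ∑ j, ((M j i : ℤ) : ℂ) • x j) :
    (∀ v : Fin 2 → ℚ, (M.map (Int.cast : ℤ → ℚ)).mulVec ((M.map (Int.cast : ℤ → ℚ)).mulVec v) = -((7 : ℚ) • v)) ∧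
    (∀ a b : Fin 2 → ℚ, b ⬝ᵥ (!![0, 1; -1, 0] : Matrix (Fin 2) (Fin 2) ℚ).mulVec a =
      -(a ⬝ᵥ (!![0, 1; -1, 0] : Matrix (Fin 2) (Fin 2) ℚ).mulVec b)) ∧
    (∀ i, complexBetti.map φ.hom.hom.hom 1 (x i) = ∑ j, (((M.map (Int.cast : ℤ → ℚ)) j i : ℚ) : ℂ) • x j) ∧
    (∀ i, complexBetti.map (-φ).hom.hom.hom 1 (x i) =
      ∑ j, (((-(M.map (Int.cast : ℤ → ℚ))) j i : ℚ) : ℂ) • x j) ∧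
    (∀ (h : complexBetti E.X 2) (i j : Fin 2), polarizationPairingOne E.X h 0 (x i) (x j) =
      (((!![0, 1; -1, 0] : Matrix (Fin 2) (Fin 2) ℚ) i j : ℚ) : ℂ) • cupProduct (rfl : 1 + 1 = 2) (x 0) (x 1)) ∧
    (∀ c : ℚ, Literature.Geometry.Kaehler.lefschetzPow (((c : ℚ) : ℂ) • cupProduct (rfl : 1 + 1 = 2) (x 0) (x 1)) 0 2
        (((c : ℚ) : ℂ) • cupProduct (rfl : 1 + 1 = 2) (x 0) (x 1)) =
      ((c : ℚ) : ℂ) • cupProduct (rfl : 1 + 1 = 2) (x 0) (x 1)) ∧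
    (∀ c₁ c₂ : ℂ, complexBetti.map (AbelianVariety.prodLift (AbelianVariety.fst E E ≫ φ)
        (AbelianVariety.snd E E ≫ (-φ))).hom.hom.hom 2
        (complexBetti.map (AbelianVariety.fst E E).hom.hom.hom 2 (c₁ • cupProduct (rfl : 1 + 1 = 2) (x 0) (x 1)) +
          complexBetti.map (AbelianVariety.snd E E).hom.hom.hom 2 (c₂ • cupProduct (rfl : 1 + 1 = 2) (x 0) (x 1))) =
      (7 : ℂ) • (complexBetti.map (AbelianVariety.fst E E).hom.hom.hom 2 (c₁ • cupProduct (rfl : 1 + 1 = 2) (x 0) (x 1)) +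
          complexBetti.map (AbelianVariety.snd E E).hom.hom.hom 2 (c₂ • cupProduct (rfl : 1 + 1 = 2) (x 0) (x 1)))) :=
  ⟨af_ME_mulVec_mulVec hφ x hxi M hM, af_GE_antisymm, af_map_eq_sum_ratCast φ x M hM,
    af_map_neg_eq_sum_ratCast φ x M hM, af_gram_curve x, af_top_curve _, af_partner_symm hE hφ _⟩

end Summit.HodgeConjecture.HodgeConjecture.Theorems.WeilTwelvefoldsSqrtMinus7.AmnesicSecantSheaves

end
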